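/-
Copyright (c) 2026 the pub-hodgecm-mathlib formalisation cell (harness21).  Prover seat hodgecm-mathlib-A-p14 (g32), P6 «MOD programme»,
P6a desk F0P6a-plan (g1) 18:52:58Z ASK (R-1 blocker) «`geomResidueField w` has characteristic `p`»; 2026-09-01.
-/
import Literature.NumberTheory.DiophantineGeometry.AbelianVarietyOrdinaryReduction
import Mathlib.Algebra.CharP.Basic
import Mathlib.Algebra.CharP.Algebra
import HarnessLib

/-!
# The geometric residue field `κ̄(v)` of a finite place `v ∣ p` of a number field has characteristic `p`

Topic `NumberTheory/DiophantineGeometry`, namespace `Literature.NumberTheory.DiophantineGeometry` (home of ★ `geomResidueField v := AlgebraicClosure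
v.asIdeal.ResidueField`, `AbelianVarietyOrdinaryReduction` :96).  THEOREMS ONLY (no definition, no `instance` — the `CharP ∕ ExpChar ∕ Fact` witnesses are
returned as THEOREMS so that consumers thread them explicitly, `@kerFI _ _ pChar f (inst…)`; no notation, no named fact, no `sorry`).  Cell `hodgecm-mathlib`
(D-0151), F0/P6 «MOD», P6a desk F0P6a-plan (g1) CANDIDATE 18:52:58Z, named remainder (R-1)∕(R-2) BLOCKER: «`relFrobeniusOver p f G` ∕ `kerFI` take
`[ExpChar κ̄(w) p]` as an INSTANCE and there is NO ★ `CharP∕ExpChar (geomResidueField w) _`»; this file supplies them from the datum՚s `hpChar : pChar.Prime ∧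
↑pChar ∈ 𝔭_w`.  `--supports stmt-HodgeConjecture-24832`, COUNT-NEUTRAL.  HONEST LABEL: HC_CM is proved only modulo the 2 remaining named inputs (hLiu418 24832,
h413 24833) until rung 0 closes; this file discharges none of them.

## Mathematics

For a prime `p` with `(p : 𝓞 K) ∈ v` (i.e. `v ∣ p`): `p ↦ 0` under `𝓞 K → κ(v) = v.asIdeal.ResidueField` (Mathlib `Ideal.algebraMap_residueField_eq_zero`), so
the field `κ(v)` has characteristic `p` (Mathlib `CharP.charP_iff_prime_eq_zero`), hence so has its algebraic closure `κ̄(v)` (Mathlib: `CharP (AlgebraicClosure k) p`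
from `CharP k p`), and `ExpChar κ̄(v) p` (`p` prime).  Conversely `CharP κ̄(v) p ⇒ (p : 𝓞 K) ∈ v` (injectivity of `κ(v) → κ̄(v)`), and the residue characteristic
is unique.  [Neukirch1999] Ch. I §8 (residue fields of `𝓞_K` at a prime over `p` are finite of characteristic `p`); [SerreTate1968] §1 (notation `k̄ = κ̄(v)`).

## Contents

* `natCast_residueField_eq_zero`, **`charP_residueField`** (`κ(v)`), **`charP_geomResidueField`**, **`expChar_geomResidueField`**, `fact_prime` (the `Fact`
  witness for `@`-threading), `ringChar_geomResidueField`, converse `natCast_mem_asIdeal_of_charP_geomResidueField`, uniqueness `eq_of_charP_geomResidueField`.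

## References
* [Neukirch1999] J. Neukirch, *Algebraic Number Theory* (1999), Ch. I §8 (primes of `𝓞_K` over `p`, residue fields).
* [SerreTate1968] J.-P. Serre, J. Tate, *Good reduction of abelian varieties*, Ann. of Math. 88 (1968), §1 (the residue field `k` and `k̄`).
-/

set_option autoImplicit false

open NumberField IsDedekindDomain

namespace Literature.NumberTheory.DiophantineGeometry

variable {K : Type} [Field K] (v : HeightOneSpectrum (𝓞 K)) {p : ℕ}

/-- `p ↦ 0` in the residue field `κ(v)` when `(p : 𝓞 K) ∈ v`. [cite: Neukirch1999, Ch. I §8] -/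
theorem natCast_residueField_eq_zero (hpv : (p : 𝓞 K) ∈ v.asIdeal) : (p : v.asIdeal.ResidueField) = 0 := by
  rw [← map_natCast (algebraMap (𝓞 K) v.asIdeal.ResidueField) p]
  exact Ideal.algebraMap_residueField_eq_zero.2 hpv

/-- **`κ(v)` has characteristic `p`** for a prime `p` with `(p : 𝓞 K) ∈ v`. [cite: Neukirch1999, Ch. I §8] -/
theorem charP_residueField (hp : p.Prime) (hpv : (p : 𝓞 K) ∈ v.asIdeal) : CharP v.asIdeal.ResidueField p :=
  (CharP.charP_iff_prime_eq_zero hp).2 (natCast_residueField_eq_zero v hpv)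

/-- **`κ̄(v) = geomResidueField v` has characteristic `p`** for a prime `p` with `(p : 𝓞 K) ∈ v` (a THEOREM, to be threaded explicitly; Mathlib՚s
`CharP (AlgebraicClosure k) p` instance from `CharP k p`). [cite: Neukirch1999, Ch. I §8] [cite: SerreTate1968, §1] -/
theorem charP_geomResidueField (hp : p.Prime) (hpv : (p : 𝓞 K) ∈ v.asIdeal) : CharP (geomResidueField v) p := by
  haveI := charP_residueField v hp hpv
  exact inferInstance

/-- **`ExpChar (geomResidueField v) p`** for a prime `p` with `(p : 𝓞 K) ∈ v`. [cite: Neukirch1999, Ch. I §8] -/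
theorem expChar_geomResidueField (hp : p.Prime) (hpv : (p : 𝓞 K) ∈ v.asIdeal) : ExpChar (geomResidueField v) p := by
  haveI := charP_geomResidueField v hp hpv
  exact ExpChar.prime hp

/-- The `Fact p.Prime` witness (for `@`-threading next to `charP_geomResidueField`). [cite: Neukirch1999, Ch. I §8] -/
theorem fact_prime (hp : p.Prime) : Fact p.Prime := ⟨hp⟩

/-- `ringChar κ̄(v) = p`. [cite: Neukirch1999, Ch. I §8] -/
theorem ringChar_geomResidueField (hp : p.Prime) (hpv : (p : 𝓞 K) ∈ v.asIdeal) : ringChar (geomResidueField v) = p := by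
  haveI := charP_geomResidueField v hp hpv
  exact ringChar.eq (geomResidueField v) p

/-- Converse: if `κ̄(v)` has characteristic `p` then `(p : 𝓞 K) ∈ v` (injectivity of `κ(v) → κ̄(v)`). [cite: Neukirch1999, Ch. I §8] -/
theorem natCast_mem_asIdeal_of_charP_geomResidueField [CharP (geomResidueField v) p] : (p : 𝓞 K) ∈ v.asIdeal := by
  rw [← Ideal.algebraMap_residueField_eq_zero (I := v.asIdeal), map_natCast]
  have h : algebraMap v.asIdeal.ResidueField (geomResidueField v) (p : v.asIdeal.ResidueField) = 0 := by
    rw [map_natCast]; exact CharP.cast_eq_zero (geomResidueField v) p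
  exact (map_eq_zero_iff _ (algebraMap v.asIdeal.ResidueField (geomResidueField v)).injective).1 h

/-- Uniqueness of the residue characteristic: two primes `p`, `q` lying in `v` coincide. [cite: Neukirch1999, Ch. I §8] -/
theorem eq_of_natCast_mem_asIdeal {q : ℕ} (hp : p.Prime) (hq : q.Prime) (hpv : (p : 𝓞 K) ∈ v.asIdeal) (hqv : (q : 𝓞 K) ∈ v.asIdeal) : p = q := by
  rw [← ringChar_geomResidueField v hp hpv, ← ringChar_geomResidueField v hq hqv]

end Literature.NumberTheory.DiophantineGeometry
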